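import Summits.QuantumFields.YangMills.Theorems.PencilRigidityWeakCouplingHypercubicLimitColdPressureClustering
import Summits.QuantumFields.YangMills.Theorems.PencilRigidityWeakCouplingHypercubicLimitStubRpSpectralOfColdPressure
import Summits.QuantumFields.YangMills.Theorems.MirrorModularBoostsHypercubicLimitClosureHalvesDefs
import Summits.QuantumFields.YangMills.Theorems.LangevinControlUVOSLegsAtWeakCouplingCStubCluster
import HarnessLib

/-!
# Crux `WeakCouplingHypercubicLimit` (stmt-QuantumFields-16120), line `Sketch`, reshape r10: the two bridges

Helper file of the lead (c4) for the r10 skeleton `Cruxes/WeakCouplingHypercubicLimit/Lines/Sketch.lean`, whose heart is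
now LATTICE-SIDE and whose composition runs through the twin crux stmt-16154's landed closure vocabulary
(`MirrorModularBoostsHypercubicLimit*Defs*`: `IRInputs`, `RPSpectral`, `SoftHalf`, `ReflHalf`) and the sibling cruxes'
landed continuum theorems (`OSLegsFromFemtoAndGap`: `stub_gap`, `tendsto_conn_translateMulti_smul`,
`isHermitian_of_isReflectionPositive`).  Two pure-logic bridges over LANDED theorems:

* `hasLatticeMassGap_anti` — the uniform lattice gap clause is antitone in the rate;
* `irInputsAB_of_coldPressure` (registered sub-goal) — **cold pressure ⇒ clauses (a),(b) of `IRInputs`**: along a scheme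
  with `β_k ≥ 0` eventually, the volume floor + the cold-pressure bound at rate `Δ` give `HasLatticeMassGap r sch (Δ/4)`
  (landed `stub_latticeGapOfColdPressure`) and `RPSpectral r sch (Δ/4) (16 K)` (landed `rpSpectral_of_coldPressure_scheme`,
  verbatim); `irInputs_of_coldPressure` adds the two floors (c),(d) as hypotheses and returns `IRInputs r sch` — the
  statement that lets the twin's closure consume this line's infrared output;
* `reflHalf_of_pieces` (registered sub-goal, closed form `reflHalf_of_pieces'`) — **the reflection half of the
  one-field clauses from four inputs**: E0-normalisation + translations on `⁰𝒮` (soft half), `RPPos`, signed-permutation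
  invariance on `⁰𝒮`, and `Decay Δ`; E2 by `isReflectionPositive_of_rpPos`, hermiticity by
  `isHermitian_of_isReflectionPositive`, `ConnCS` and `HasMassGap Δ` by `stub_gap`, E4 by `tendsto_conn_translateMulti_smul`.

Refs: OsterwalderSchrader1973 §3; OsterwalderSeiler1978 §§2–3; GlimmJaffe1987 §6.1, §19.7; JaffeWitten2000 §§4–5.
-/

noncomputable section

open scoped SchwartzMap
open MeasureTheory Filter Topology
open Literature.MathematicalPhysics.QuantumFieldTheory Literature.MathematicalPhysics.QuantumLattice
open Literature.MathematicalPhysics.AQFT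
open Summit.QuantumFields.YangMills.Cruxes.HypercubicLimit.CouplingResponse
open Summit.QuantumFields.YangMills.Cruxes.OSLegsFromFemtoAndGap.DlrCollarTransfer (conn Decay RPPos ConnCS)

namespace Summit.QuantumFields.YangMills.Theorems.WeakCouplingHypercubicLimit.TraceNormColdPressure

/-- **`HasLatticeMassGap` is antitone in the rate**: a volume-uniform lattice gap at rate `Δ` is one at every rate
`Δ' ≤ Δ` (constant `max C 0`). [folklore] -/
theorem hasLatticeMassGap_anti {G : Type} [Group G] [TopologicalSpace G] [IsTopologicalGroup G] [CompactSpace G]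
    [MeasurableSpace G] [BorelSpace G] {ι : Type} (r : LatticeRep G) (sch : SpeciesScheme ι) {Δ Δ' : ℝ}
    (h : HasLatticeMassGap r sch Δ) (hle : Δ' ≤ Δ) : HasLatticeMassGap r sch Δ' := by
  intro A B
  obtain ⟨C, hC⟩ := h A B
  refine ⟨max C 0, hC.mono fun k hk S hS n hn => (hk S hS n hn).trans ?_⟩
  have han : 0 ≤ sch.a k * n := mul_nonneg (sch.a_pos k).le (Nat.cast_nonneg n)
  calc C * Real.exp (-(Δ * (sch.a k * n)))
      ≤ max C 0 * Real.exp (-(Δ * (sch.a k * n))) :=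
        mul_le_mul_of_nonneg_right (le_max_left _ _) (Real.exp_nonneg _)
    _ ≤ max C 0 * Real.exp (-(Δ' * (sch.a k * n))) :=
        mul_le_mul_of_nonneg_left (Real.exp_le_exp.2 (by nlinarith)) (le_max_right _ _)

/-- **Registered sub-goal `irInputsAB_of_coldPressure` (line `Sketch`, r10): cold pressure ⇒ `IRInputs` (a) ∧ (b).**
Along a scheme with `β_k ≥ 0` eventually, the volume floor and the cold-pressure bound at rate `Δ > 0` give the
uniform lattice gap `HasLatticeMassGap r sch (Δ/4)` and the RP-spectral relative clustering `RPSpectral r sch (Δ/4) (16 K)`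
of reflected slab functionals (the twin stmt-16154's clauses (a),(b)). [folklore] -/
theorem irInputsAB_of_coldPressure :
    ∀ (G : Type) [Group G] [TopologicalSpace G] [IsTopologicalGroup G] [CompactSpace G]
      [MeasurableSpace G] [BorelSpace G] (r : LatticeRep G) (sch : SpeciesScheme (YMSpecies G)) (Δ C₀ K : ℝ),
      (∀ᶠ k in Filter.atTop, 0 ≤ sch.β k) → 0 < Δ → 0 ≤ C₀ →
      (∀ᶠ k in Filter.atTop, ∀ S : ℕ, sch.L k ≤ S →
        C₀ * ((2 * S + 1 : ℕ) : ℝ) ^ 3 * Real.exp (-(Δ * sch.a k * S / 2)) ≤ K) →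
      (∀ᶠ k in Filter.atTop, ∀ S : ℕ, sch.L k ≤ S → ∀ m : ℕ, S + 1 ≤ 2 * (m + 2) →
        traceExcess r.ρ (sch.β k) (2 * S + 1) (m + 2) ≤
          C₀ * ((2 * S + 1 : ℕ) : ℝ) ^ 3 * Real.exp (-(Δ * sch.a k * ((m + 2 : ℕ) : ℝ)))) →
      HasLatticeMassGap r sch (Δ / 4) ∧ RPSpectral r sch (Δ / 4) (16 * K) := by
  intro G _ _ _ _ _ _ r sch Δ C₀ K hβ hΔ hC₀ hK hP
  exact ⟨hasLatticeMassGap_anti r sch (stub_latticeGapOfColdPressure G r sch Δ C₀ K hβ hΔ hC₀ hK hP) (by linarith),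
    rpSpectral_of_coldPressure_scheme G r (YMSpecies G) sch Δ C₀ K hβ hΔ hC₀ hK hP⟩

/-- **Cold pressure + the two lattice floors ⇒ `IRInputs`** (the twin's imported infrared input, in full): clauses
(a),(b) from `irInputsAB_of_coldPressure` at rate `Δ/4`, clauses (c),(d) verbatim as hypotheses. [folklore] -/
theorem irInputs_of_coldPressure {G : Type} [Group G] [TopologicalSpace G] [IsTopologicalGroup G] [CompactSpace G]
    [MeasurableSpace G] [BorelSpace G] (r : LatticeRep G) (sch : SpeciesScheme (YMSpecies G)) {Δ C₀ K : ℝ}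
    (hβ : ∀ᶠ k in Filter.atTop, 0 ≤ sch.β k) (hΔ : 0 < Δ) (hC₀ : 0 ≤ C₀)
    (hK : ∀ᶠ k in Filter.atTop, ∀ S : ℕ, sch.L k ≤ S →
      C₀ * ((2 * S + 1 : ℕ) : ℝ) ^ 3 * Real.exp (-(Δ * sch.a k * S / 2)) ≤ K)
    (hP : ∀ᶠ k in Filter.atTop, ∀ S : ℕ, sch.L k ≤ S → ∀ m : ℕ, S + 1 ≤ 2 * (m + 2) →
      traceExcess r.ρ (sch.β k) (2 * S + 1) (m + 2) ≤
        C₀ * ((2 * S + 1 : ℕ) : ℝ) ^ 3 * Real.exp (-(Δ * sch.a k * ((m + 2 : ℕ) : ℝ))))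
    (hNT : ∃ (u v : 𝓢(EuclideanSpace ℝ (Fin 4), ℝ)) (δ : ℝ),
      tsupport u ⊆ {y : EuclideanSpace ℝ (Fin 4) | y 0 < 0} ∧
      tsupport v ⊆ {y : EuclideanSpace ℝ (Fin 4) | 0 < y 0} ∧ 0 < δ ∧
      ∀ᶠ k in atTop, δ ≤
        |latticeSchwinger r.ρ sch (fun s => s.F) k (1 + 1) (fun _ => r.curvature) ![u, v] -
          latticeSchwinger r.ρ sch (fun s => s.F) k 1 (fun _ => r.curvature) ![u] *
            latticeSchwinger r.ρ sch (fun s => s.F) k 1 (fun _ => r.curvature) ![v]|)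
    (hNG : ∃ (f g h : 𝓢(EuclideanSpace ℝ (Fin 4), ℝ)) (δ : ℝ),
      Disjoint (tsupport f) (tsupport g) ∧ Disjoint (tsupport f) (tsupport h) ∧
      Disjoint (tsupport g) (tsupport h) ∧ 0 < δ ∧
      ∀ᶠ k in atTop, δ ≤
        |latticeSchwinger r.ρ sch (fun s => s.F) k 3 (fun _ => r.curvature) ![f, g, h] -
          latticeSchwinger r.ρ sch (fun s => s.F) k 1 (fun _ => r.curvature) ![f] *
            latticeSchwinger r.ρ sch (fun s => s.F) k 2 (fun _ => r.curvature) ![g, h] -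
          latticeSchwinger r.ρ sch (fun s => s.F) k 1 (fun _ => r.curvature) ![g] *
            latticeSchwinger r.ρ sch (fun s => s.F) k 2 (fun _ => r.curvature) ![f, h] -
          latticeSchwinger r.ρ sch (fun s => s.F) k 1 (fun _ => r.curvature) ![h] *
            latticeSchwinger r.ρ sch (fun s => s.F) k 2 (fun _ => r.curvature) ![f, g] +
          2 * (latticeSchwinger r.ρ sch (fun s => s.F) k 1 (fun _ => r.curvature) ![f] *
            latticeSchwinger r.ρ sch (fun s => s.F) k 1 (fun _ => r.curvature) ![g] *
            latticeSchwinger r.ρ sch (fun s => s.F) k 1 (fun _ => r.curvature) ![h])|) :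
    IRInputs r sch := by
  obtain ⟨hgap, hrp⟩ := irInputsAB_of_coldPressure G r sch Δ C₀ K hβ hΔ hC₀ hK hP
  exact (irInputs_iff r sch).2 ⟨⟨Δ / 4, 16 * K, by positivity, hgap, hrp⟩, hNT, hNG⟩

/-- **Assembly of the reflection half from the r10 pieces** (pure logic over landed continuum theorems): for a one-field
family with E0-normalisation and translation invariance on `⁰𝒮`, reflection positivity on positive-time off-diagonal
tuples (`RPPos`), signed-permutation invariance on `⁰𝒮` and the diagonal decay `Decay Δ` (`Δ > 0`):
E2 (`isReflectionPositive_of_rpPos`), hermiticity (`isHermitian_of_isReflectionPositive`), `HasMassGap Δ` (`stub_gap`),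
E4 (`tendsto_conn_translateMulti_smul`), the det-1 hypercubic clause (a sub-case) — i.e. `ReflHalf S₁ Δ`. [folklore] -/
theorem reflHalf_of_pieces (S₁ : SchwingerFamily (EuclideanSpace ℝ (Fin 4))) {Δ : ℝ} (hΔ : 0 < Δ)
    (hN : S₁.toLabelled.IsNormalized)
    (htrans : ∀ (n : ℕ) (k : Fin n → Unit) (a : EuclideanSpace ℝ (Fin 4))
      (F : 𝓢((Fin n → EuclideanSpace ℝ (Fin 4)), ℂ)), IsOffDiagonal F →
      S₁.toLabelled n k (translateMulti a F) = S₁.toLabelled n k F)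
    (hRP : RPPos S₁)
    (hsigned : ∀ (n : ℕ) (R : EuclideanSpace ℝ (Fin 4) ≃ₗᵢ[ℝ] EuclideanSpace ℝ (Fin 4)),
      (∀ i : Fin 4, ∃ j : Fin 4, R (EuclideanSpace.single i 1) = EuclideanSpace.single j 1 ∨
        R (EuclideanSpace.single i 1) = -EuclideanSpace.single j 1) →
      ∀ F : 𝓢((Fin n → EuclideanSpace ℝ (Fin 4)), ℂ), IsOffDiagonal F → S₁ n (linActMulti R F) = S₁ n F)
    (hD : Decay S₁ Δ) : ReflHalf S₁ Δ := by
  have hN' : ∀ F : 𝓢((Fin 0 → EuclideanSpace ℝ (Fin 4)), ℂ), S₁ 0 F = F default := fun F =>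
    (hN (fun _ => ()) F).trans (congrArg F (Subsingleton.elim _ _))
  have htrans' : ∀ (n : ℕ) (t : EuclideanSpace ℝ (Fin 4)) (F : 𝓢((Fin n → EuclideanSpace ℝ (Fin 4)), ℂ)),
      IsOffDiagonal F → S₁ n (translateMulti t F) = S₁ n F := fun n t F hF => htrans n (fun _ => ()) t F hF
  have hE2 : S₁.toLabelled.IsReflectionPositive :=
    Summit.QuantumFields.YangMills.Cruxes.OSLegsFromFemtoAndGap.DlrCollarTransfer.isReflectionPositive_of_rpPos hRP
  obtain ⟨hCS, hgap⟩ :=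
    Summit.QuantumFields.YangMills.Cruxes.OSLegsFromFemtoAndGap.DlrCollarTransfer.stub_gap S₁ hN' htrans' hRP
  refine ⟨Summit.QuantumFields.YangMills.Theorems.OSLegsFromFemtoAndGap.isHermitian_of_isReflectionPositive S₁ hN hE2,
    hE2, ?_, fun n k R _hdet hR F hF => hsigned n R hR F hF, hgap Δ hΔ hD⟩
  -- E4 in every spatial direction
  intro n m k k' F G hF hG a ha0 ha H hH
  have hHeq : ∀ t, H t = (osAdjoint F).appendTensor (translateMulti (t • a) G) := fun t => by
    ext x; rw [hH t x, SchwartzMap.appendTensor_apply]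
  have hred : ∀ t, S₁ (n + m) (H t) - S₁ n (osAdjoint F) * S₁ m G = conn S₁ F (translateMulti (t • a) G) :=
    fun t => by rw [hHeq t, conn, htrans' m _ _ hG.isOffDiagonal]
  simp only [SchwingerFamily.toLabelled_apply, hred]
  exact Summit.QuantumFields.YangMills.Theorems.OSLegsFromFemtoAndGap.tendsto_conn_translateMulti_smul S₁ hΔ htrans'
    hsigned hCS hD hF hG ha0 ha

/-- **Registered sub-goal `reflHalf_of_pieces'` (line `Sketch`, r10)**: closed form of `reflHalf_of_pieces`. [folklore] -/
theorem reflHalf_of_pieces' :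
    ∀ (S₁ : SchwingerFamily (EuclideanSpace ℝ (Fin 4))) (Δ : ℝ), 0 < Δ → S₁.toLabelled.IsNormalized →
      (∀ (n : ℕ) (k : Fin n → Unit) (a : EuclideanSpace ℝ (Fin 4)) (F : 𝓢((Fin n → EuclideanSpace ℝ (Fin 4)), ℂ)),
        IsOffDiagonal F → S₁.toLabelled n k (translateMulti a F) = S₁.toLabelled n k F) →
      RPPos S₁ →
      (∀ (n : ℕ) (R : EuclideanSpace ℝ (Fin 4) ≃ₗᵢ[ℝ] EuclideanSpace ℝ (Fin 4)),
        (∀ i : Fin 4, ∃ j : Fin 4, R (EuclideanSpace.single i 1) = EuclideanSpace.single j 1 ∨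
          R (EuclideanSpace.single i 1) = -EuclideanSpace.single j 1) →
        ∀ F : 𝓢((Fin n → EuclideanSpace ℝ (Fin 4)), ℂ), IsOffDiagonal F → S₁ n (linActMulti R F) = S₁ n F) →
      Decay S₁ Δ → ReflHalf S₁ Δ :=
  fun S₁ _ hΔ hN htrans hRP hsigned hD => reflHalf_of_pieces S₁ hΔ hN htrans hRP hsigned hD

end Summit.QuantumFields.YangMills.Theorems.WeakCouplingHypercubicLimit.TraceNormColdPressure

end
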